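import Summits.QuantumFields.BalabanUV.T4Continuum.Support.NE7EtaBackgroundCarrier

/-!
# NE7EtaBackgroundEmbedding — route #1 of the NE7 crux, stub S7 (NODE O, the BACKGROUND COORDINATE): T.2's embedding socket `ι : C.BgA → E`,
# `hgauge : ‖ι U − ι U'‖ ≤ C.gauge U U'` INHABITED on the carrier `NE7EtaBackgroundCarrier.bgCarriers` — the graded (value, plain-gradient)
# restriction into the `ℓ^∞` direct sum over levels of finite sup-normed slots (located constraint (F1) resolved on the carrier side)

Cell `pub-balaban`, rung (B)+1 sub-cell t4, lineage `b2b-balaban-t4-ne7-p1`, generation 25 (CRUX PROVER NE7 #1, ruling e34b3e0c); crux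
skeleton `t4/skeletons/NE7-CRUX-R1.md` v1.7.5 §3sexies ∕ §5 (G5); companion of `NE7EtaBackgroundCarrier` (p258129, the instance) and
`NE7EtaBackgroundCloseness` (the closeness binder).  HONEST FRAMING (page 1): FIXED FINITE T⁴, rung (B)+1; NE7, NE3 NOT PRINTED in
[Balaban1984PropagatorsI]–[Balaban1989LargeFieldII] and NOT PROVED here; continuum YM on T⁴ ⇐ BetaPertH ∧ nine spine estimates (0/9 proved);
BetaPertH ⇐ (D1) ∧ (D4) ∧ CAP+tail; G-an2-4 gates asym, D1 and NE2/3/4; NOT infinite volume, NOT mass gap, NOT Clay.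

WHY.  Route 1 consumes the Lipschitz-in-the-background bracket through T.2 `TermwiseAnalyticMarginLayered.lipBackground_of_layeredMargin`, whose
carrier-side data are ONE complex normed space `E` (`[NormedAddCommGroup E] [NormedSpace ℂ E]`), an embedding `ι : C.BgA → E` and the
domination `hgauge : ∀ U U', ‖ι U − ι U'‖ ≤ C.gauge U U'` (located constraint (F1) of p256062: the norm must weigh bond values by `ξ⁻¹ = L^k`
AND plain lattice gradients by `ξ⁻² = L^{2k}` — the two-radius box (1.13) p. 262 of [Balaban1987RG1]).  This file supplies exactly these
three data for `bgCarriers` and proves `hgauge`; the functional-side data of T.2 (`Dch`, `Φ`, `N`, `ϱ₀`, `Ec`, analyticity, the creation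
margin on the OCCURRING backgrounds — constraint (F4) of p258129) remain NODE O's functional half (ownerless, XL) and are NOT touched.
WHAT ([folklore] bookkeeping; three small definitions).
 * `Slot n L N k` = `(periodBox (N L^k) × Fin 4 → M_n(ℂ)) × (periodBox (N L^k) × Fin 4 × Fin 4 → M_n(ℂ))` with the product∕Pi SUP norms
   (operator norm on `M_n(ℂ)`, scope `Matrix.Norms.L2Operator`); `graded L N k F = (L^k • F|box, (L^k)² • ∇F|box)` (plain forward
   differences based in the box); `graded_sub` (additivity); `norm_graded_le : ‖graded L N k F‖ ≤ reading L N k F` (each coordinate is below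
   the corresponding `Real.iSup`; `pi_norm_le_iff_of_nonneg`, `Prod.norm_def`).
 * `Amb n L N = lp (fun k => Slot n L N k) ∞` — ONE complex normed space for all levels; `iota … U = lp.single ∞ k (graded L N k (valCfg U))`
   for `U = ⟨(k, U), _⟩ : (bgCarriers …).BgA`.
 * **`norm_iota_sub_le`** ∕ **`hgauge_bgCarriers`**: `‖ι U − ι U'‖ ≤ (bgCarriers …).gauge U U'` for ALL pairs — same level: `lp.single_sub`,
   `lp.norm_single`, `graded_sub`, `norm_graded_le` against `plainReading`; across levels: triangle inequality against the SUM of the two tagged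
   sizes (this is why `levelGauge` sums across levels).  LITERALLY T.2's binder `hgauge` with `E := Amb n L N`, `ι := iota …`.
HONEST.  Bookkeeping over finite sup norms and `lp.single`; no estimate; nothing of Bałaban asserted; nothing of NE3∕NE7 discharged; the
functional half of NODE O (T.2's remaining eight hypotheses) is untouched; 0 sorry.
-/

set_option autoImplicit false

open scoped BigOperators Matrix Matrix.Norms.L2Operator ENNReal
open Finset NormedSpace

namespace Summit.QuantumFields.BalabanUV.T4Continuum.NE7EtaBackgroundEmbedding

open Literature.MathematicalPhysics.QuantumFieldTheory.Balaban1983to89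
open B7Prop1Explicit B7Prop2Explicit
open T4AveragingDeficitWall hiding Site Plane Plaq Bond
open T4AveragingDeficitWallBoundary (periodBox IsPeriodicCfg)
open T4OutputRate (Carriers)
open NE7EtaBackgroundCarrier

noncomputable section

variable {n : Type} [Fintype n] [DecidableEq n]

/-! ## §1 The level slots and the graded restriction -/

variable (n) in
/-- The level-`k` SLOT: (bond values on the period box) × (plain forward differences based in the period box), matrix-valued, with the
sup-norm of the product of the two finite function spaces. [folklore] -/
abbrev Slot (L N k : ℕ) : Type :=
  (↥(periodBox (d := 4) (N * L ^ k)) × Fin 4 → Matrix n n ℂ) × (↥(periodBox (d := 4) (N * L ^ k)) × Fin 4 × Fin 4 → Matrix n n ℂ)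

/-- The GRADED restriction of a matrix-valued bond function to the level-`k` slot: values weighted by `L^k = ξ⁻¹`, plain forward differences
weighted by `(L^k)² = ξ⁻²`. [folklore] -/
def graded (L N k : ℕ) (F : Site 4 → Fin 4 → Matrix n n ℂ) : Slot n L N k :=
  (fun b => ((L : ℂ) ^ k) • F (b.1 : Site 4) b.2,
    fun t => (((L : ℂ) ^ k) ^ 2) • (F ((t.1 : Site 4) + e t.2.1) t.2.2 - F (t.1 : Site 4) t.2.2))

omit [Fintype n] [DecidableEq n] in
/-- `graded` is additive: `graded (F − F') = graded F − graded F'`. [folklore] -/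
theorem graded_sub (L N k : ℕ) (F F' : Site 4 → Fin 4 → Matrix n n ℂ) :
    graded L N k (fun x κ => F x κ - F' x κ) = graded L N k F - graded L N k F' := by
  ext b : 2
  · simp only [graded, Prod.fst_sub, Pi.sub_apply, smul_sub]
  · simp only [graded, Prod.snd_sub, Pi.sub_apply, smul_sub]
    abel

/-- `‖(L : ℂ)^k‖ = L^k`. [folklore] -/
theorem norm_Lpow (L k : ℕ) : ‖((L : ℂ) ^ k)‖ = (L : ℝ) ^ k := by
  rw [norm_pow, Complex.norm_natCast]

/-- A bond value based in `S` is below `supVal S` (finite range ⇒ bounded above). [folklore] -/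
theorem norm_le_supVal {S : Finset (Site 4)} (F : Site 4 → Fin 4 → Matrix n n ℂ) (b : ↥S × Fin 4) :
    ‖F (b.1 : Site 4) b.2‖ ≤ supVal S F :=
  le_ciSup (f := fun b : ↥S × Fin 4 => ‖F (b.1 : Site 4) b.2‖) (Set.finite_range _).bddAbove b

/-- A plain forward difference based in `S` is below `supGrad S`. [folklore] -/
theorem norm_le_supGrad {S : Finset (Site 4)} (F : Site 4 → Fin 4 → Matrix n n ℂ) (t : ↥S × Fin 4 × Fin 4) :
    ‖F ((t.1 : Site 4) + e t.2.1) t.2.2 - F (t.1 : Site 4) t.2.2‖ ≤ supGrad S F :=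
  le_ciSup (f := fun t : ↥S × Fin 4 × Fin 4 => ‖F ((t.1 : Site 4) + e t.2.1) t.2.2 - F (t.1 : Site 4) t.2.2‖)
    (Set.finite_range _).bddAbove t

/-- **THE SLOT NORM OF THE GRADED RESTRICTION IS BELOW THE READING**: `‖graded L N k F‖ ≤ reading L N k F`. [folklore] -/
theorem norm_graded_le (L N k : ℕ) (F : Site 4 → Fin 4 → Matrix n n ℂ) : ‖graded L N k F‖ ≤ reading L N k F := by
  have hL : 0 ≤ (L : ℝ) ^ k := by positivity
  rw [Prod.norm_def]
  refine max_le_max ?_ ?_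
  · refine (pi_norm_le_iff_of_nonneg (mul_nonneg hL (supVal_nonneg _ _))).2 fun b => ?_
    change ‖((L : ℂ) ^ k) • F (b.1 : Site 4) b.2‖ ≤ _
    rw [norm_smul, norm_Lpow]
    exact mul_le_mul_of_nonneg_left (norm_le_supVal F b) hL
  · refine (pi_norm_le_iff_of_nonneg (mul_nonneg (by positivity) (supGrad_nonneg _ _))).2 fun t => ?_
    change ‖(((L : ℂ) ^ k) ^ 2) • (F ((t.1 : Site 4) + e t.2.1) t.2.2 - F (t.1 : Site 4) t.2.2)‖ ≤ _
    rw [norm_smul, norm_pow, norm_Lpow]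
    exact mul_le_mul_of_nonneg_left (norm_le_supGrad F t) (by positivity)

/-! ## §2 The embedding into ONE complex normed space and T.2's `hgauge` -/

variable (n) in
/-- The ambient space: the `ℓ^∞` direct sum over levels of the slots. [folklore] -/
abbrev Amb (L N : ℕ) : Type := lp (fun k : ℕ => Slot n L N k) ∞

/-- **THE EMBEDDING `ι` OF T.2's SOCKET ON THE BACKGROUND-COORDINATE CARRIER**: a level-tagged background `(k, U)` goes to the graded restriction
of its bond values placed in slot `k`. [folklore] -/
def iota [Nonempty n] (L N : ℕ) (D : Type) (sc : D → ℕ) (dl : D → ℝ) (hdl : ∀ X, 0 ≤ dl X)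
    (admA admB : ℕ → Set (Site 4 → Fin 4 → (Matrix n n ℂ)ˣ))
    (hmaps : ∀ (k : ℕ) (U : Site 4 → Fin 4 → (Matrix n n ℂ)ˣ), U ∈ admB k → rescale L (bavg L U) ∈ admA k)
    (U : (bgCarriers n L N D sc dl hdl admA admB hmaps).BgA) : Amb n L N :=
  lp.single ∞ U.1.1 (graded L N U.1.1 (valCfg U.1.2))

/-- **T.2's `hgauge` HOLDS**: `‖ι U − ι U'‖ ≤ C.gauge U U'` for ALL pairs of run-A backgrounds of the carrier (same level: the slot norm of the
graded difference is below the plain reading; across levels: triangle inequality against the sum of the two tagged sizes). [folklore] -/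
theorem norm_iota_sub_le [Nonempty n] (L N : ℕ) (D : Type) (sc : D → ℕ) (dl : D → ℝ) (hdl : ∀ X, 0 ≤ dl X)
    (admA admB : ℕ → Set (Site 4 → Fin 4 → (Matrix n n ℂ)ˣ))
    (hmaps : ∀ (k : ℕ) (U : Site 4 → Fin 4 → (Matrix n n ℂ)ˣ), U ∈ admB k → rescale L (bavg L U) ∈ admA k)
    (U U' : (bgCarriers n L N D sc dl hdl admA admB hmaps).BgA) :
    ‖iota L N D sc dl hdl admA admB hmaps U - iota L N D sc dl hdl admA admB hmaps U'‖
      ≤ (bgCarriers n L N D sc dl hdl admA admB hmaps).gauge U U' := by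
  obtain ⟨⟨k, V⟩, hV⟩ := U
  obtain ⟨⟨k', V'⟩, hV'⟩ := U'
  rw [bgCarriers_gauge]
  unfold iota levelGauge
  dsimp only
  by_cases hk : k = k'
  · subst hk
    rw [if_pos rfl, ← lp.single_sub, lp.norm_single (by simp), ← graded_sub]
    exact norm_graded_le L N k _
  · rw [if_neg hk]
    calc ‖lp.single ∞ k (graded L N k (valCfg V)) - lp.single ∞ k' (graded L N k' (valCfg V'))‖
        ≤ ‖lp.single ∞ k (graded L N k (valCfg V))‖ + ‖lp.single ∞ k' (graded L N k' (valCfg V'))‖ := norm_sub_le _ _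
      _ = ‖graded L N k (valCfg V)‖ + ‖graded L N k' (valCfg V')‖ := by
          rw [lp.norm_single (by simp), lp.norm_single (by simp)]
      _ ≤ reading L N k (valCfg V) + reading L N k' (valCfg V') := add_le_add (norm_graded_le _ _ _ _) (norm_graded_le _ _ _ _)

/-- **T.2's CARRIER-SIDE SOCKET, BUNDLED**: with `E := Amb n L N` and `ι := iota …`, the binder
`hgauge : ∀ U U' : C.BgA, ‖ι U − ι U'‖ ≤ C.gauge U U'` of `TermwiseAnalyticMarginLayered.lipBackground_of_layeredMargin` holds on
`bgCarriers` (hence on `occCarriers`, which is `bgCarriers` on the occurring classes). [folklore] -/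
theorem hgauge_bgCarriers [Nonempty n] (L N : ℕ) (D : Type) (sc : D → ℕ) (dl : D → ℝ) (hdl : ∀ X, 0 ≤ dl X)
    (admA admB : ℕ → Set (Site 4 → Fin 4 → (Matrix n n ℂ)ˣ))
    (hmaps : ∀ (k : ℕ) (U : Site 4 → Fin 4 → (Matrix n n ℂ)ˣ), U ∈ admB k → rescale L (bavg L U) ∈ admA k) :
    ∀ U U' : (bgCarriers n L N D sc dl hdl admA admB hmaps).BgA,
      ‖iota L N D sc dl hdl admA admB hmaps U - iota L N D sc dl hdl admA admB hmaps U'‖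
        ≤ (bgCarriers n L N D sc dl hdl admA admB hmaps).gauge U U' :=
  norm_iota_sub_le L N D sc dl hdl admA admB hmaps

/-- The same on the carrier of the OCCURRING classes `occCarriers` (definitionally `bgCarriers` on `occA`, `occB`). [folklore] -/
theorem hgauge_occCarriers [Nonempty n] (L N : ℕ) (ε : ℝ) (dom : Set (Site 4 → Fin 4 → (Matrix n n ℂ)ˣ)) (D : Type) (sc : D → ℕ)
    (dl : D → ℝ) (hdl : ∀ X, 0 ≤ dl X) :
    ∀ U U' : (occCarriers n L N ε dom D sc dl hdl).BgA,
      ‖iota L N D sc dl hdl (occA L N ε dom) (occB L N ε dom) (rescale_bavg_mem_occA L N ε dom) U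
          - iota L N D sc dl hdl (occA L N ε dom) (occB L N ε dom) (rescale_bavg_mem_occA L N ε dom) U'‖
        ≤ (occCarriers n L N ε dom D sc dl hdl).gauge U U' :=
  norm_iota_sub_le L N D sc dl hdl (occA L N ε dom) (occB L N ε dom) (rescale_bavg_mem_occA L N ε dom)

end

end Summit.QuantumFields.BalabanUV.T4Continuum.NE7EtaBackgroundEmbedding
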